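import Literature.Analysis.Complex.AbhyankarJungAnalytic
import Literature.Analysis.Complex.OsgoodProofs
import Literature.RingTheory.MvPowerSeries.OfAnalytic
import Literature.RingTheory.MvPowerSeries.EvalAnalytic
import Mathlib.Topology.MetricSpace.Thickening
import Mathlib.Analysis.Normed.Module.Convex
import Mathlib.RingTheory.Polynomial.Resultant.Basic
import Mathlib.Algebra.MvPolynomial.Funext
import HarnessLib

/-!
# The Abhyankar–Jung theorem for real-analytic coefficients near the closed unit cube

Topic `Literature/Analysis/Complex` (namespace `Literature.Analysis.Complex.AbhyankarJung`).
The real form used by the Kontsevich–Zagier cube normal form (crux `CubeNashNormalForm`, line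
`jung-descent-abhyankar-toric`): let `P_x(Z) = Zⁿ + Σ aₖ(x) Zᵏ` have coefficients REAL-analytic on an
open neighbourhood `U` of the closed cube `[0,1]ᵈ ⊆ ℝᵈ` and discriminant
`Res(P_x, P_x') = (∏ xᵢ^{αᵢ})·e(x)` with `e` analytic and nowhere zero on `U`. Then after a ramification
`xᵢ = σᵢ^N` the complexified polynomial splits into linear factors `Z − ζₗ(σ)` with
`ζₗ : ℝᵈ → ℂ` real-analytic on a neighbourhood of the closed cube (`exists_roots_pow_real`).

Steps: complexification of real-analytic functions near the cube to holomorphic functions on a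
complex thickening of the cube (`exists_complexification`: local convergent power series read over
`ℂ`, glued by the totally real identity principle `eqOn_zero_of_forall_real`), transfer of the
discriminant identity, the analytic theorem `exists_roots_pow` on the product of planar
thickenings of `[0,1]`, and restriction to real points. Everything is proved; no definitions, no
named facts.

## References

* A. Parusiński, G. Rond, *The Abhyankar–Jung theorem*, J. Algebra 365 (2012) 29–41, Prop. 2.1.
* S. S. Abhyankar, *On the ramification of algebraic functions*, Amer. J. Math. 77 (1955), Thm. 3.
-/

noncomputable section

open Complex Metric Set Filter Polynomial Topology
open scoped Real NNReal ENNReal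

namespace Literature.Analysis.Complex
namespace AbhyankarJung

variable {d : ℕ}

/-! ### Real points of `ℂᵈ` -/

/-- A complex polynomial in `d` variables vanishing at all real points is zero. [folklore] -/
theorem mvPolynomial_eq_zero_of_forall_real (Q : MvPolynomial (Fin d) ℂ)
    (hQ : ∀ y : Fin d → ℝ, MvPolynomial.eval (fun i => (y i : ℂ)) Q = 0) : Q = 0 := by
  classical
  -- real and imaginary parts of the coefficients give real polynomials vanishing identically
  set Qre : MvPolynomial (Fin d) ℝ := ∑ α ∈ Q.support, MvPolynomial.monomial α (Q.coeff α).re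
    with hQre
  set Qim : MvPolynomial (Fin d) ℝ := ∑ α ∈ Q.support, MvPolynomial.monomial α (Q.coeff α).im
    with hQim
  have heval : ∀ y : Fin d → ℝ, MvPolynomial.eval (fun i => (y i : ℂ)) Q =
      (MvPolynomial.eval y Qre : ℂ) + (MvPolynomial.eval y Qim : ℂ) * I := by
    intro y
    rw [MvPolynomial.eval_eq (fun i => (y i : ℂ)) Q, hQre, hQim, map_sum, map_sum, ofReal_sum, ofReal_sum,
      Finset.sum_mul, ← Finset.sum_add_distrib]
    refine Finset.sum_congr rfl fun α _ => ?_
    rw [MvPolynomial.eval_monomial, MvPolynomial.eval_monomial, ofReal_mul, ofReal_mul]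
    have hprod : (∏ i ∈ α.support, ((y i : ℂ)) ^ α i) =
        ((α.prod fun i k => y i ^ k : ℝ) : ℂ) := by
      rw [Finsupp.prod, ofReal_prod]
      simp
    rw [hprod]
    set pr : ℝ := α.prod fun i k => y i ^ k
    calc Q.coeff α * (pr : ℂ) = (((Q.coeff α).re : ℂ) + ((Q.coeff α).im : ℂ) * I) * (pr : ℂ) := by
          rw [re_add_im]
      _ = ((Q.coeff α).re : ℂ) * (pr : ℂ) + ((Q.coeff α).im : ℂ) * (pr : ℂ) * I := by ring
  have hre : ∀ y : Fin d → ℝ, MvPolynomial.eval y Qre = 0 := by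
    intro y
    have h := hQ y
    rw [heval y] at h
    have := congrArg Complex.re h
    simpa using this
  have him : ∀ y : Fin d → ℝ, MvPolynomial.eval y Qim = 0 := by
    intro y
    have h := hQ y
    rw [heval y] at h
    have := congrArg Complex.im h
    simpa using this
  have hQre0 : Qre = 0 := MvPolynomial.funext fun y => by rw [hre y, map_zero]
  have hQim0 : Qim = 0 := MvPolynomial.funext fun y => by rw [him y, map_zero]
  -- read off the coefficients
  have hcoeff : ∀ α, Q.coeff α = 0 := by
    intro α
    by_cases hα : α ∈ Q.support
    · have h1 : Qre.coeff α = (Q.coeff α).re := by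
        rw [hQre, MvPolynomial.coeff_sum, Finset.sum_eq_single α]
        · rw [MvPolynomial.coeff_monomial, if_pos rfl]
        · intro β _ hβ; rw [MvPolynomial.coeff_monomial, if_neg hβ]
        · intro h; exact absurd hα h
      have h2 : Qim.coeff α = (Q.coeff α).im := by
        rw [hQim, MvPolynomial.coeff_sum, Finset.sum_eq_single α]
        · rw [MvPolynomial.coeff_monomial, if_pos rfl]
        · intro β _ hβ; rw [MvPolynomial.coeff_monomial, if_neg hβ]
        · intro h; exact absurd hα h
      rw [hQre0, MvPolynomial.coeff_zero] at h1
      rw [hQim0, MvPolynomial.coeff_zero] at h2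
      exact Complex.ext (by simpa using h1.symm) (by simpa using h2.symm)
    · exact MvPolynomial.notMem_support_iff.1 hα
  exact MvPolynomial.ext _ _ fun α => by rw [hcoeff α, MvPolynomial.coeff_zero]

/-- **Totally real identity principle.** A function holomorphic on a preconnected open
`W ⊆ ℂᵈ` which vanishes at all real points of `W`, and such that `W` contains a real point, vanishes
on `W`: at a real point its power series (Osgood) has diagonal polynomials vanishing on `ℝᵈ`
(`HasFPowerSeriesAt.apply_eq_zero` for the restriction to `ℝᵈ`), hence vanishing
(`mvPolynomial_eq_zero_of_forall_real`), so the function vanishes near the point and the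
identity theorem applies. [folklore] -/
theorem eqOn_zero_of_forall_real {G : (Fin d → ℂ) → ℂ} {W : Set (Fin d → ℂ)} (hW : IsOpen W)
    (hWc : IsPreconnected W) (hG : DifferentiableOn ℂ G W)
    (hreal : ∀ y : Fin d → ℝ, (fun i => (y i : ℂ)) ∈ W → G (fun i => (y i : ℂ)) = 0)
    {t : Fin d → ℝ} (ht : (fun i => (t i : ℂ)) ∈ W) : EqOn G 0 W := by
  -- the real embedding
  set L : (Fin d → ℝ) →L[ℝ] (Fin d → ℂ) :=
    ContinuousLinearMap.pi fun i => Complex.ofRealCLM.comp (ContinuousLinearMap.proj i) with hL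
  have hLapp : ∀ y : Fin d → ℝ, L y = fun i => (y i : ℂ) := fun y => rfl
  set x₀ : Fin d → ℂ := fun i => (t i : ℂ) with hx₀
  -- power series at the real point
  have hGan : AnalyticOnNhd ℂ G W := SCV.analyticOnNhd_of_differentiableOn hG hW
  obtain ⟨P, r, hP⟩ := hGan x₀ ht
  -- the restriction to `ℝᵈ` has the composed power series and vanishes near `t`
  have hPℝ : HasFPowerSeriesAt (G ∘ L) ((P.restrictScalars ℝ).compContinuousLinearMap L) t := by
    have h1 : HasFPowerSeriesAt G (P.restrictScalars ℝ) (L t) := (hP.hasFPowerSeriesAt).restrictScalars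
    exact h1.compContinuousLinearMap
  have hzero : (G ∘ L) =ᶠ[𝓝 t] 0 := by
    have hmem : ∀ᶠ y in 𝓝 t, L y ∈ W := L.continuous.continuousAt.preimage_mem_nhds (hW.mem_nhds ht)
    filter_upwards [hmem] with y hy
    exact hreal y hy
  have hP0 : HasFPowerSeriesAt 0 ((P.restrictScalars ℝ).compContinuousLinearMap L) t :=
    hPℝ.congr hzero
  -- diagonal values vanish on real vectors, hence on complex vectors
  have hdiag_real : ∀ (m : ℕ) (y : Fin d → ℝ), P m (fun _ => L y) = 0 := by
    intro m y
    have := hP0.apply_eq_zero m y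
    simpa [FormalMultilinearSeries.compContinuousLinearMap] using this
  have hdiag : ∀ (m : ℕ) (h : Fin d → ℂ), P m (fun _ => h) = 0 := by
    intro m h
    classical
    set Q : MvPolynomial (Fin d) ℂ := ∑ τ : Fin m → Fin d,
      MvPolynomial.monomial (∑ l, Finsupp.single (τ l) 1) (P m fun l => Pi.single (τ l) 1) with hQ
    have hQeval : ∀ z : Fin d → ℂ, MvPolynomial.eval z Q = P m fun _ => z := fun z =>
      Literature.RingTheory.MvPowerSeries.eval_diagPoly (P m) z
    have hQ0 : Q = 0 := mvPolynomial_eq_zero_of_forall_real Q fun y => by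
      rw [hQeval]; exact hdiag_real m y
    rw [← hQeval h, hQ0, map_zero]
  -- `G` vanishes near `x₀`
  have hGx₀ : G =ᶠ[𝓝 x₀] 0 := by
    have hball : Metric.eball x₀ r ∈ 𝓝 x₀ := Metric.eball_mem_nhds x₀ hP.r_pos
    filter_upwards [hball] with z hz
    have hsum := hP.hasSum_sub hz
    have h0 : HasSum (fun m : ℕ => P m fun _ => z - x₀) 0 := by
      simp only [hdiag]; exact hasSum_zero
    exact hsum.unique h0
  exact hGan.eqOn_zero_of_preconnected_of_eventuallyEq_zero hWc ht hGx₀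

/-! ### Complexification of a real-analytic function near the closed cube -/

/-- Reading a real power series over `ℂ` does not change its weighted norms. [folklore] -/
theorem wnorm_map_ofReal (ρ : Fin d → ℝ≥0) (Q : MvPowerSeries (Fin d) ℝ) :
    Literature.RingTheory.MvPowerSeries.wnorm ρ (MvPowerSeries.map (algebraMap ℝ ℂ) Q) =
      Literature.RingTheory.MvPowerSeries.wnorm ρ Q := by
  unfold Literature.RingTheory.MvPowerSeries.wnorm
  refine tsum_congr fun α => ?_
  rw [MvPowerSeries.coeff_map]
  simp

/-- Reading a real power series over `ℂ` and evaluating at a real point of its polydisc gives the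
real value. [folklore] -/
theorem eval_map_ofReal {ρ : Fin d → ℝ≥0} {Q : MvPowerSeries (Fin d) ℝ}
    (hQ : Literature.RingTheory.MvPowerSeries.wnorm ρ Q < ⊤) {y : Fin d → ℝ} (hy : ∀ i, ‖y i‖₊ ≤ ρ i) :
    Literature.RingTheory.MvPowerSeries.eval (MvPowerSeries.map (algebraMap ℝ ℂ) Q) (fun i => (y i : ℂ)) =
      ((Literature.RingTheory.MvPowerSeries.eval Q y : ℝ) : ℂ) := by
  have h1 := Literature.RingTheory.MvPowerSeries.hasSum_eval hy hQ
  have h2 : HasSum (fun α => ((MvPowerSeries.coeff α Q * Literature.RingTheory.MvPowerSeries.mono y α : ℝ) : ℂ))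
      ((Literature.RingTheory.MvPowerSeries.eval Q y : ℝ) : ℂ) :=
    (h1.map Complex.ofRealCLM Complex.ofRealCLM.continuous :)
  have hy' : ∀ i, ‖((y i : ℂ))‖₊ ≤ ρ i := fun i => by simpa using hy i
  have hQ' : Literature.RingTheory.MvPowerSeries.wnorm ρ (MvPowerSeries.map (algebraMap ℝ ℂ) Q) < ⊤ := by
    rw [wnorm_map_ofReal]; exact hQ
  have h3 := Literature.RingTheory.MvPowerSeries.hasSum_eval hy' hQ'
  have hfun : (fun α => MvPowerSeries.coeff α (MvPowerSeries.map (algebraMap ℝ ℂ) Q) *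
      Literature.RingTheory.MvPowerSeries.mono (fun i => (y i : ℂ)) α) =
      fun α => ((MvPowerSeries.coeff α Q * Literature.RingTheory.MvPowerSeries.mono y α : ℝ) : ℂ) := by
    funext α
    rw [MvPowerSeries.coeff_map, ofReal_mul]
    congr 1
    unfold Literature.RingTheory.MvPowerSeries.mono
    rw [Finsupp.prod, Finsupp.prod, ofReal_prod]
    simp
  rw [hfun] at h3
  exact h3.unique h2

/-- Membership in the complex `ρ`-thickening of the closed real cube `[0,1]ᵈ` (sup metric) is read
coordinatewise: `Z` is within `ρ` of the cube iff each `Zᵢ` is within `ρ` of `[0,1]`. [folklore] -/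
theorem mem_thickening_cube_iff {ρ : ℝ} (hρ : 0 < ρ) (Z : Fin d → ℂ) :
    Z ∈ thickening ρ ((fun y : Fin d → ℝ => fun i => (y i : ℂ)) '' Set.pi univ fun _ => Icc (0 : ℝ) 1) ↔
      ∀ i, ∃ t ∈ Icc (0 : ℝ) 1, ‖Z i - t‖ < ρ := by
  rw [mem_thickening_iff]
  constructor
  · rintro ⟨_, ⟨y, hy, rfl⟩, hdist⟩
    intro i
    refine ⟨y i, (mem_univ_pi.1 hy) i, ?_⟩
    rcases Nat.eq_zero_or_pos d with hd | hd
    · subst hd; exact (Fin.elim0 i)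
    · haveI : Nonempty (Fin d) := ⟨⟨0, hd⟩⟩
      have := (dist_pi_lt_iff hρ).1 hdist i
      rwa [dist_eq_norm] at this
  · intro h
    choose t ht hlt using h
    refine ⟨fun i => (t i : ℂ), ⟨t, mem_univ_pi.2 ht, rfl⟩, ?_⟩
    rcases isEmpty_or_nonempty (Fin d) with hd | hd
    · rw [Subsingleton.elim Z (fun i => (t i : ℂ)), dist_self]; exact hρ
    · exact (dist_pi_lt_iff hρ).2 fun i => by rw [dist_eq_norm]; exact hlt i

/-- Real points of the complex thickening of the cube are close to the real cube. [folklore] -/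
theorem mem_thickening_real_of_mem_thickening_cube {ρ : ℝ} (hρ : 0 < ρ) {y : Fin d → ℝ}
    (hy : (fun i => (y i : ℂ)) ∈
      thickening ρ ((fun y : Fin d → ℝ => fun i => (y i : ℂ)) '' Set.pi univ fun _ => Icc (0 : ℝ) 1)) :
    y ∈ thickening ρ (Set.pi univ fun _ : Fin d => Icc (0 : ℝ) 1) := by
  rw [mem_thickening_cube_iff hρ] at hy
  choose t ht hlt using hy
  rw [mem_thickening_iff]
  refine ⟨t, mem_univ_pi.2 ht, ?_⟩
  rcases isEmpty_or_nonempty (Fin d) with hd | hd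
  · rw [Subsingleton.elim y t, dist_self]; exact hρ
  · refine (dist_pi_lt_iff hρ).2 fun i => ?_
    rw [Real.dist_eq]
    have := hlt i
    rwa [← ofReal_sub, norm_real, Real.norm_eq_abs] at this

/-- **Complexification near the closed cube.** A function real-analytic on an open neighbourhood
`U` of the closed cube `[0,1]ᵈ` extends to a function holomorphic on a complex `ρ`-thickening of the
cube agreeing with it at real points (which all lie in `U`): finitely many local convergent power
series (tree `OfAnalytic`) read over `ℂ` (tree `EvalAnalytic`), glued by the totally real identity
principle on the convex overlaps of their polydiscs. [folklore] -/
theorem exists_complexification {φ : (Fin d → ℝ) → ℝ} {U : Set (Fin d → ℝ)} (hU : IsOpen U)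
    (hKU : (Set.pi univ fun _ : Fin d => Icc (0 : ℝ) 1) ⊆ U) (hφ : AnalyticOnNhd ℝ φ U) :
    ∃ ρ : ℝ, 0 < ρ ∧
      (∀ y : Fin d → ℝ, (fun i => (y i : ℂ)) ∈
        thickening ρ ((fun y : Fin d → ℝ => fun i => (y i : ℂ)) '' Set.pi univ fun _ => Icc (0 : ℝ) 1) →
        y ∈ U) ∧
      ∃ Φ : (Fin d → ℂ) → ℂ,
        DifferentiableOn ℂ Φ
          (thickening ρ ((fun y : Fin d → ℝ => fun i => (y i : ℂ)) '' Set.pi univ fun _ => Icc (0 : ℝ) 1)) ∧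
        ∀ y : Fin d → ℝ, (fun i => (y i : ℂ)) ∈
          thickening ρ ((fun y : Fin d → ℝ => fun i => (y i : ℂ)) '' Set.pi univ fun _ => Icc (0 : ℝ) 1) →
          Φ (fun i => (y i : ℂ)) = φ y := by
  classical
  set K : Set (Fin d → ℝ) := Set.pi univ fun _ : Fin d => Icc (0 : ℝ) 1 with hK
  set ι : (Fin d → ℝ) → (Fin d → ℂ) := fun y i => (y i : ℂ) with hι
  have hKc : IsCompact K := isCompact_univ_pi fun _ => isCompact_Icc
  -- a real thickening of the cube inside `U`
  obtain ⟨ρU, hρU, hρUsub⟩ := hKc.exists_thickening_subset_open hU hKU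
  -- finitely many local power series, half-radius polydiscs covering the cube
  obtain ⟨s, r, Q, hsK, hQ, hcover⟩ :=
    Literature.RingTheory.MvPowerSeries.exists_finset_cover_eval_eq_of_analyticOnNhd_shrink
      hφ hKc hKU (c := 1 / 2) (by norm_num)
  -- the cube is nonempty, so is `s`
  have hKne : K.Nonempty := ⟨fun _ => 0, mem_univ_pi.2 fun _ => ⟨le_rfl, zero_le_one⟩⟩
  have hsne : s.Nonempty := by
    obtain ⟨y, hy⟩ := hKne
    obtain ⟨x, hx, -⟩ := mem_iUnion₂.1 (hcover hy)
    exact ⟨x, hx⟩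
  -- the radius
  set ρ : ℝ := min ρU (s.inf' hsne fun x => (r x : ℝ) / 2) with hρ
  have hρpos : 0 < ρ :=
    lt_min hρU ((Finset.lt_inf'_iff hsne).2 fun x hx => half_pos (NNReal.coe_pos.2 (hQ x hx).1))
  have hρle : ∀ x ∈ s, ρ ≤ (r x : ℝ) / 2 := fun x hx =>
    (min_le_right _ _).trans (Finset.inf'_le _ hx)
  -- local holomorphic extensions
  set Φloc : (Fin d → ℝ) → (Fin d → ℂ) → ℂ := fun x Z =>
    Literature.RingTheory.MvPowerSeries.eval (MvPowerSeries.map (algebraMap ℝ ℂ) (Q x)) (Z - ι x)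
    with hΦloc
  set D : (Fin d → ℝ) → Set (Fin d → ℂ) := fun x => {Z | ∀ i, ‖Z i - (x i : ℂ)‖₊ < r x} with hD
  have hDo : ∀ x, IsOpen (D x) := by
    intro x
    have : D x = ⋂ i, (fun Z : Fin d → ℂ => ‖Z i - (x i : ℂ)‖₊) ⁻¹' Iio (r x) := by ext Z; simp [hD]
    rw [this]
    exact isOpen_iInter_of_finite fun i => isOpen_Iio.preimage (by fun_prop)
  have hDconv : ∀ x, Convex ℝ (D x) := by
    intro x
    have : D x = ⋂ i, {Z : Fin d → ℂ | Z i ∈ Metric.ball ((x i : ℂ)) (r x)} := by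
      ext Z
      simp only [hD, mem_setOf_eq, mem_iInter, Metric.mem_ball, dist_eq_norm]
      exact forall_congr' fun i => by rw [← NNReal.coe_lt_coe, coe_nnnorm]
    rw [this]
    refine convex_iInter fun i => ?_
    exact (convex_ball _ _).linear_preimage (LinearMap.proj i : (Fin d → ℂ) →ₗ[ℝ] ℂ)
  have hΦloc_diff : ∀ x ∈ s, DifferentiableOn ℂ (Φloc x) (D x) := by
    intro x hx Z hZ
    have hw : Literature.RingTheory.MvPowerSeries.wnorm (fun _ : Fin d => r x)
        (MvPowerSeries.map (algebraMap ℝ ℂ) (Q x)) < ⊤ := by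
      rw [wnorm_map_ofReal]; exact (hQ x hx).2.1
    have han := Literature.RingTheory.MvPowerSeries.analyticAt_eval hw (y := Z - ι x)
      (fun i => by simpa [hι] using hZ i)
    have hf : AnalyticAt ℂ (fun Z : Fin d → ℂ => Z - ι x) Z := analyticAt_id.sub analyticAt_const
    exact (AnalyticAt.comp (f := fun Z : Fin d → ℂ => Z - ι x) (x := Z) han hf).differentiableAt.differentiableWithinAt
  have hΦloc_real : ∀ x ∈ s, ∀ y : Fin d → ℝ, (∀ i, ‖y i - x i‖₊ ≤ r x) → Φloc x (ι y) = φ y := by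
    intro x hx y hy
    have hsub : ι y - ι x = fun i => ((y i - x i : ℝ) : ℂ) := by funext i; simp [hι]
    simp only [hΦloc]
    rw [hsub, eval_map_ofReal (ρ := fun _ => r x) (hQ x hx).2.1 (fun i => hy i)]
    exact congrArg _ ((hQ x hx).2.2 y hy)
  -- two local extensions agree on the overlap of their polydiscs
  have hagree : ∀ x ∈ s, ∀ x' ∈ s, EqOn (Φloc x) (Φloc x') (D x ∩ D x') := by
    intro x hx x' hx' Z hZ
    have hWo : IsOpen (D x ∩ D x') := (hDo x).inter (hDo x')
    have hWc : IsPreconnected (D x ∩ D x') := ((hDconv x).inter (hDconv x')).isPreconnected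
    have hG : DifferentiableOn ℂ (fun Z => Φloc x Z - Φloc x' Z) (D x ∩ D x') :=
      ((hΦloc_diff x hx).mono inter_subset_left).sub ((hΦloc_diff x' hx').mono inter_subset_right)
    -- the real point below `Z`
    set t : Fin d → ℝ := fun i => (Z i).re with ht
    have hre : ∀ (w : ℂ) (a : ℝ), ‖((w.re : ℂ)) - a‖₊ ≤ ‖w - a‖₊ := by
      intro w a
      have : ((w.re : ℂ)) - a = (((w - a).re : ℝ) : ℂ) := by simp
      rw [this]
      have h1 : ‖(((w - a).re : ℝ) : ℂ)‖ ≤ ‖w - a‖ := by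
        rw [norm_real, Real.norm_eq_abs]; exact abs_re_le_norm _
      exact h1
    have htW : ι t ∈ D x ∩ D x' :=
      ⟨fun i => lt_of_le_of_lt (hre _ _) (hZ.1 i), fun i => lt_of_le_of_lt (hre _ _) (hZ.2 i)⟩
    have hreal : ∀ y : Fin d → ℝ, ι y ∈ D x ∩ D x' → Φloc x (ι y) - Φloc x' (ι y) = 0 := by
      intro y hy
      have h1 : ∀ i, ‖y i - x i‖₊ ≤ r x := fun i => by
        have := (hy.1 i).le; simpa [hι, ← ofReal_sub] using this
      have h2 : ∀ i, ‖y i - x' i‖₊ ≤ r x' := fun i => by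
        have := (hy.2 i).le; simpa [hι, ← ofReal_sub] using this
      rw [hΦloc_real x hx y h1, hΦloc_real x' hx' y h2, sub_self]
    have := eqOn_zero_of_forall_real hWo hWc hG hreal htW hZ
    exact sub_eq_zero.1 this
  -- every point of the thickening lies in the polydisc of some centre
  have hmemD : ∀ Z, Z ∈ thickening ρ (ι '' K) → ∃ x ∈ s, Z ∈ D x := by
    intro Z hZ
    rw [mem_thickening_cube_iff hρpos] at hZ
    choose t ht hlt using hZ
    have htK : t ∈ K := mem_univ_pi.2 ht
    obtain ⟨x, hx, hxt⟩ := mem_iUnion₂.1 (hcover htK)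
    refine ⟨x, hx, fun i => ?_⟩
    have h1 : (‖t i - x i‖₊ : ℝ) < 1 / 2 * r x := by exact_mod_cast hxt i
    have h2 : ‖Z i - (x i : ℂ)‖ ≤ ‖Z i - (t i : ℂ)‖ + ‖((t i : ℂ)) - (x i : ℂ)‖ := norm_sub_le_norm_sub_add_norm_sub _ _ _
    have h3 : ‖((t i : ℂ)) - (x i : ℂ)‖ = ‖t i - x i‖ := by rw [← ofReal_sub, norm_real]
    have h4 : (‖Z i - (x i : ℂ)‖₊ : ℝ) < r x := by
      push_cast
      calc ‖Z i - (x i : ℂ)‖ ≤ ‖Z i - (t i : ℂ)‖ + ‖t i - x i‖ := by rw [← h3]; exact h2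
        _ < ρ + 1 / 2 * r x := add_lt_add (hlt i) (by simpa using h1)
        _ ≤ (r x : ℝ) / 2 + 1 / 2 * r x := by gcongr; exact hρle x hx
        _ = r x := by ring
    exact_mod_cast h4
  -- the global extension
  set Φ : (Fin d → ℂ) → ℂ := fun Z =>
    if h : ∃ x ∈ s, Z ∈ D x then Φloc (Classical.choose h) Z else 0 with hΦ
  have hΦeq : ∀ x ∈ s, ∀ Z ∈ D x, Φ Z = Φloc x Z := by
    intro x hx Z hZ
    have h : ∃ x ∈ s, Z ∈ D x := ⟨x, hx, hZ⟩
    simp only [hΦ, dif_pos h]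
    exact hagree _ (Classical.choose_spec h).1 x hx ⟨(Classical.choose_spec h).2, hZ⟩
  refine ⟨ρ, hρpos, fun y hy => hρUsub ?_, Φ, fun Z hZ => ?_, fun y hy => ?_⟩
  · -- real points lie in `U`
    exact thickening_mono (min_le_left _ _) K (mem_thickening_real_of_mem_thickening_cube hρpos hy)
  · -- holomorphy
    obtain ⟨x, hx, hZx⟩ := hmemD Z hZ
    have hev : Φ =ᶠ[𝓝 Z] Φloc x := by
      filter_upwards [(hDo x).mem_nhds hZx] with Z' hZ'
      exact hΦeq x hx Z' hZ'
    exact (((hΦloc_diff x hx).differentiableAt ((hDo x).mem_nhds hZx)).congr_of_eventuallyEq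
      hev).differentiableWithinAt
  · -- real values
    obtain ⟨x, hx, hyx⟩ := hmemD _ hy
    rw [hΦeq x hx _ hyx]
    exact hΦloc_real x hx y fun i => by
      have := (hyx i).le; simpa [hι, ← ofReal_sub] using this

/-! ### The real Abhyankar–Jung theorem -/

/-- Degree of the family `Zⁿ + Σ_{k<n} cₖ Zᵏ` over a nontrivial ring. [folklore] -/
theorem natDegree_X_pow_add_sum {R : Type*} [CommRing R] [Nontrivial R] {n : ℕ} (c : Fin n → R) :
    (X ^ n + ∑ k : Fin n, C (c k) * X ^ (k : ℕ)).natDegree = n := by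
  have hdeg : (∑ k : Fin n, C (c k) * X ^ (k : ℕ)).degree < (n : WithBot ℕ) := by
    refine (degree_sum_le _ _).trans_lt ?_
    refine (Finset.sup_lt_iff (WithBot.bot_lt_coe n)).2 fun k _ => ?_
    exact (degree_C_mul_X_pow_le (k : ℕ) (c k)).trans_lt (WithBot.coe_lt_coe.2 k.2)
  rw [natDegree_add_eq_left_of_degree_lt, natDegree_X_pow]
  rwa [degree_X_pow]

/-- The family `Zⁿ + Σ_{k<n} cₖ Zᵏ` is monic, hence non-zero. [folklore] -/
theorem X_pow_add_sum_ne_zero {R : Type*} [CommRing R] [Nontrivial R] {n : ℕ} (c : Fin n → R) :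
    (X ^ n + ∑ k : Fin n, C (c k) * X ^ (k : ℕ)) ≠ 0 := by
  have hdeg : (∑ k : Fin n, C (c k) * X ^ (k : ℕ)).degree < (n : WithBot ℕ) := by
    refine (degree_sum_le _ _).trans_lt ?_
    refine (Finset.sup_lt_iff (WithBot.bot_lt_coe n)).2 fun k _ => ?_
    exact (degree_C_mul_X_pow_le (k : ℕ) (c k)).trans_lt (WithBot.coe_lt_coe.2 k.2)
  exact (monic_X_pow_add hdeg).ne_zero

/-- **The Abhyankar–Jung theorem, real-analytic form near the closed cube.** Let
`P_x(Z) = Zⁿ + Σ_{k<n} aₖ(x) Zᵏ` have coefficients real-analytic on an open neighbourhood `U` of the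
closed cube `[0,1]ᵈ`, and suppose `Res(P_x, P_x') = (∏ᵢ xᵢ^{αᵢ}) · e(x)` on `U` with `e` analytic and
nowhere zero. Then there are `N ≥ 1`, an open `V ⊇ [0,1]ᵈ` with `σ^N ∈ U` for `σ ∈ V`, and
functions `ζ₁, …, ζₙ : ℝᵈ → ℂ` real-analytic on `V` such that the complexification of `P_{σ^N}`
is `∏ₗ (Z − ζₗ(σ))` for all `σ ∈ V`. Proof: complexify the data to a complex thickening of the cube
(`exists_complexification`), transfer the discriminant identity by the totally real identity
principle, apply the analytic theorem `exists_roots_pow` on the product of the planar thickenings of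
`[0,1]`, and restrict to real points.
[Parusiński–Rond 2012, Prop. 2.1 and Thm. 1.3; Abhyankar 1955, Thm. 3]
[cite: ParusinskiRond2012, Prop. 2.1] -/
theorem exists_roots_pow_real (n : ℕ) (U : Set (Fin d → ℝ)) (hU : IsOpen U)
    (hKU : (Set.pi univ fun _ : Fin d => Icc (0 : ℝ) 1) ⊆ U)
    (a : Fin n → (Fin d → ℝ) → ℝ) (α : Fin d → ℕ) (e : (Fin d → ℝ) → ℝ)
    (ha : ∀ k, AnalyticOnNhd ℝ (a k) U) (he : AnalyticOnNhd ℝ e U) (he0 : ∀ x ∈ U, e x ≠ 0)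
    (hdisc : ∀ x ∈ U, Polynomial.resultant (X ^ n + ∑ k : Fin n, C (a k x) * X ^ (k : ℕ))
        (derivative (X ^ n + ∑ k : Fin n, C (a k x) * X ^ (k : ℕ))) = (∏ i, x i ^ α i) * e x) :
    ∃ N : ℕ, 0 < N ∧ ∃ V : Set (Fin d → ℝ), IsOpen V ∧
      (Set.pi univ fun _ : Fin d => Icc (0 : ℝ) 1) ⊆ V ∧ (∀ σ ∈ V, (fun i => σ i ^ N) ∈ U) ∧
      ∃ ζ : Fin n → (Fin d → ℝ) → ℂ, (∀ l, AnalyticOnNhd ℝ (ζ l) V) ∧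
        ∀ σ ∈ V, (X ^ n + ∑ k : Fin n, C (a k (fun i => σ i ^ N)) * X ^ (k : ℕ)).map (algebraMap ℝ ℂ) =
          ∏ l, (X - C (ζ l σ)) := by
  classical
  set K : Set (Fin d → ℝ) := Set.pi univ fun _ : Fin d => Icc (0 : ℝ) 1 with hK
  set ι : (Fin d → ℝ) → (Fin d → ℂ) := fun y i => (y i : ℂ) with hι
  set Kc : Set (Fin d → ℂ) := ι '' K with hKc
  have hιc : Continuous ι := continuous_pi fun i => continuous_ofReal.comp (continuous_apply i)
  have hKcpt : IsCompact K := isCompact_univ_pi fun _ => isCompact_Icc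
  have hKccpt : IsCompact Kc := hKcpt.image hιc
  have h0K : (fun _ => (0 : ℝ)) ∈ K := mem_univ_pi.2 fun _ => ⟨le_rfl, zero_le_one⟩
  -- complexify the coefficients and the unit
  choose ρa hρa hUa A hAd hAre using fun k => exists_complexification hU hKU (ha k)
  obtain ⟨ρe, hρe, hUe, E, hEd, hEre⟩ := exists_complexification hU hKU he
  -- a thickening on which `E ≠ 0`
  have hO : IsOpen (thickening ρe Kc ∩ E ⁻¹' {0}ᶜ) :=
    hEd.continuousOn.isOpen_inter_preimage isOpen_thickening isOpen_compl_singleton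
  have hKO : Kc ⊆ thickening ρe Kc ∩ E ⁻¹' {0}ᶜ := by
    rintro _ ⟨t, ht, rfl⟩
    have h1 : ι t ∈ thickening ρe Kc := self_subset_thickening hρe _ ⟨t, ht, rfl⟩
    refine ⟨h1, ?_⟩
    show E (ι t) ∈ ({0}ᶜ : Set ℂ)
    rw [mem_compl_singleton_iff, hEre t h1, ofReal_ne_zero]
    exact he0 t (hUe t h1)
  obtain ⟨ρE, hρE, hρEsub⟩ := hKccpt.exists_thickening_subset_open hO hKO
  -- the common radius
  set rs : Finset ℝ := insert (min ρe ρE) (Finset.univ.image ρa) with hrs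
  have hrsne : rs.Nonempty := Finset.insert_nonempty _ _
  set ρ : ℝ := rs.min' hrsne with hρ
  have hρpos : 0 < ρ := by
    have hmem : ρ ∈ rs := Finset.min'_mem _ _
    rcases Finset.mem_insert.1 hmem with h | h
    · rw [h]; exact lt_min hρe hρE
    · obtain ⟨k, -, hk⟩ := Finset.mem_image.1 h
      rw [← hk]; exact hρa k
  have hρa_le : ∀ k, ρ ≤ ρa k := fun k =>
    Finset.min'_le _ _ (Finset.mem_insert_of_mem (Finset.mem_image_of_mem _ (Finset.mem_univ k)))
  have hρe_le : ρ ≤ ρe := (Finset.min'_le _ _ (Finset.mem_insert_self _ _)).trans (min_le_left _ _)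
  have hρE_le : ρ ≤ ρE := (Finset.min'_le _ _ (Finset.mem_insert_self _ _)).trans (min_le_right _ _)
  set S : Set (Fin d → ℂ) := thickening ρ Kc with hS
  have hSo : IsOpen S := isOpen_thickening
  have hSa : ∀ k, S ⊆ thickening (ρa k) Kc := fun k => thickening_mono (hρa_le k) _
  have hSe : S ⊆ thickening ρe Kc := thickening_mono hρe_le _
  have hSE : ∀ Z ∈ S, E Z ≠ 0 := fun Z hZ => (hρEsub (thickening_mono hρE_le _ hZ)).2
  have hAS : ∀ k, DifferentiableOn ℂ (A k) S := fun k => (hAd k).mono (hSa k)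
  have hES : DifferentiableOn ℂ E S := hEd.mono hSe
  -- holomorphic functions on `S` form a subring; the family and its discriminant over it
  let HS : Subring ((Fin d → ℂ) → ℂ) :=
    { carrier := {f | DifferentiableOn ℂ f S}
      mul_mem' := fun hf hg => hf.mul hg
      one_mem' := differentiableOn_const (1 : ℂ)
      add_mem' := fun hf hg => hf.add hg
      zero_mem' := differentiableOn_const (0 : ℂ)
      neg_mem' := fun hf => hf.neg }
  set PH : Polynomial HS := X ^ n + ∑ k : Fin n, C (⟨A k, hAS k⟩ : HS) * X ^ (k : ℕ) with hPH
  set evZ : (Fin d → ℂ) → HS →+* ℂ := fun Z =>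
    (Pi.evalRingHom (fun _ : Fin d → ℂ => ℂ) Z).comp HS.subtype with hevZ
  have hspec : ∀ Z, (X ^ n + ∑ k : Fin n, C (A k Z) * X ^ (k : ℕ) : ℂ[X]) = PH.map (evZ Z) := by
    intro Z
    simp only [hPH, Polynomial.map_add, Polynomial.map_pow, Polynomial.map_X, Polynomial.map_sum,
      Polynomial.map_mul, Polynomial.map_C]
    rfl
  set Δ : HS := Polynomial.resultant PH (derivative PH) n (n - 1) with hΔ
  have hΔZ : ∀ Z, Polynomial.resultant (X ^ n + ∑ k : Fin n, C (A k Z) * X ^ (k : ℕ))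
      (derivative (X ^ n + ∑ k : Fin n, C (A k Z) * X ^ (k : ℕ))) n (n - 1) =
      (Δ : (Fin d → ℂ) → ℂ) Z := by
    intro Z
    rw [hspec Z, Polynomial.derivative_map, Polynomial.resultant_map_map]
    rfl
  have hΔd : DifferentiableOn ℂ (Δ : (Fin d → ℂ) → ℂ) S := Δ.2
  -- default degrees
  have hdegℂ : ∀ Z, (X ^ n + ∑ k : Fin n, C (A k Z) * X ^ (k : ℕ) : ℂ[X]).natDegree = n := fun Z =>
    natDegree_X_pow_add_sum _
  have hdegℂ' : ∀ Z, (derivative (X ^ n + ∑ k : Fin n, C (A k Z) * X ^ (k : ℕ) : ℂ[X])).natDegree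
      = n - 1 := fun Z => by rw [natDegree_derivative, hdegℂ]
  have hdegℝ : ∀ x, (X ^ n + ∑ k : Fin n, C (a k x) * X ^ (k : ℕ) : ℝ[X]).natDegree = n := fun x =>
    natDegree_X_pow_add_sum _
  have hdegℝ' : ∀ x, (derivative (X ^ n + ∑ k : Fin n, C (a k x) * X ^ (k : ℕ) : ℝ[X])).natDegree
      = n - 1 := fun x => by rw [natDegree_derivative, hdegℝ]
  -- real points of `S`
  have hrealU : ∀ y : Fin d → ℝ, ι y ∈ S → y ∈ U := fun y hy => hUe y (hSe hy)
  have hPreal : ∀ y : Fin d → ℝ, ι y ∈ S → (X ^ n + ∑ k : Fin n, C (A k (ι y)) * X ^ (k : ℕ) : ℂ[X]) =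
      (X ^ n + ∑ k : Fin n, C (a k y) * X ^ (k : ℕ)).map (algebraMap ℝ ℂ) := by
    intro y hy
    simp only [Polynomial.map_add, Polynomial.map_pow, Polynomial.map_X, Polynomial.map_sum,
      Polynomial.map_mul, Polynomial.map_C]
    congr 1
    refine Finset.sum_congr rfl fun k _ => ?_
    rw [hAre k y (hSa k hy)]
    rfl
  -- the discriminant identity on `S`, transferred from the real points
  have hΔS : ∀ Z ∈ S, (Δ : (Fin d → ℂ) → ℂ) Z = (∏ i, Z i ^ α i) * E Z := by
    have hG : DifferentiableOn ℂ (fun Z => (Δ : (Fin d → ℂ) → ℂ) Z - (∏ i, Z i ^ α i) * E Z) S := by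
      refine hΔd.sub (DifferentiableOn.mul ?_ hES)
      intro Z _
      exact (HasFDerivAt.finsetProd (u := Finset.univ) (g := fun (i : Fin d) (Z : Fin d → ℂ) => Z i ^ α i)
        (fun i _ => ((differentiableAt_apply i Z).pow (α i)).hasFDerivAt)).differentiableAt
        |>.differentiableWithinAt
    have hKconv : Convex ℝ Kc := by
      refine (convex_pi fun _ _ => convex_Icc (0 : ℝ) 1).is_linear_image ?_
      exact ⟨fun x y => funext fun i => by simp [hι], fun c x => funext fun i => by simp [hι]⟩
    have hSc : IsPreconnected S := (hKconv.thickening ρ).isPreconnected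
    have h0S : ι (fun _ => (0 : ℝ)) ∈ S := self_subset_thickening hρpos _ ⟨_, h0K, rfl⟩
    have hreal : ∀ y : Fin d → ℝ, ι y ∈ S →
        (Δ : (Fin d → ℂ) → ℂ) (ι y) - (∏ i, ι y i ^ α i) * E (ι y) = 0 := by
      intro y hy
      rw [← hΔZ (ι y), hPreal y hy, Polynomial.derivative_map, Polynomial.resultant_map_map]
      have h1 := hdisc y (hrealU y hy)
      rw [hdegℝ, hdegℝ'] at h1
      rw [h1, hEre y (hSe hy)]
      simp [hι]
    intro Z hZ
    have := eqOn_zero_of_forall_real hSo hSc hG hreal h0S hZ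
    exact sub_eq_zero.1 this
  -- separability off the coordinate hyperplanes
  have hsepS : ∀ Z ∈ S, (∀ i, Z i ≠ 0) →
      (X ^ n + ∑ k : Fin n, C (A k Z) * X ^ (k : ℕ) : ℂ[X]).Separable := by
    intro Z hZ hZ0
    have hres : Polynomial.resultant (X ^ n + ∑ k : Fin n, C (A k Z) * X ^ (k : ℕ))
        (derivative (X ^ n + ∑ k : Fin n, C (A k Z) * X ^ (k : ℕ))) ≠ 0 := by
      rw [hdegℂ, hdegℂ', hΔZ, hΔS Z hZ]
      exact mul_ne_zero (Finset.prod_ne_zero_iff.2 fun i _ => pow_ne_zero _ (hZ0 i)) (hSE Z hZ)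
    rw [Ne, Polynomial.resultant_eq_zero_iff, not_and, not_not] at hres
    exact (Polynomial.separable_def _).2 (hres (Or.inl (X_pow_add_sum_ne_zero _)))
  -- the planar thickenings of `[0,1]` and the product domain
  set T : Fin d → Set ℂ := fun _ => thickening ρ ((fun t : ℝ => (t : ℂ)) '' Icc (0 : ℝ) 1) with hT
  have hseg_conv : Convex ℝ ((fun t : ℝ => (t : ℂ)) '' Icc (0 : ℝ) 1) :=
    (convex_Icc (0 : ℝ) 1).is_linear_image ⟨fun x y => by simp, fun c x => by simp⟩
  have hseg_bdd : Bornology.IsBounded ((fun t : ℝ => (t : ℂ)) '' Icc (0 : ℝ) 1) :=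
    (isCompact_Icc.image continuous_ofReal).isBounded
  have hTo : ∀ i, IsOpen (T i) := fun _ => isOpen_thickening
  have hTc : ∀ i, Convex ℝ (T i) := fun _ => hseg_conv.thickening ρ
  have hTb : ∀ i, Bornology.IsBounded (T i) := fun _ => hseg_bdd.thickening
  have hT0 : ∀ i, (0 : ℂ) ∈ T i := fun _ =>
    self_subset_thickening hρpos _ ⟨0, ⟨le_rfl, zero_le_one⟩, by simp⟩
  have hmemT : ∀ (z : ℂ) i, z ∈ T i ↔ ∃ t ∈ Icc (0 : ℝ) 1, ‖z - t‖ < ρ := by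
    intro z i
    simp only [hT, mem_thickening_iff, mem_image, dist_eq_norm]
    constructor
    · rintro ⟨_, ⟨t, ht, rfl⟩, h⟩; exact ⟨t, ht, h⟩
    · rintro ⟨t, ht, h⟩; exact ⟨_, ⟨t, ht, rfl⟩, h⟩
  have hST : ∀ Z : Fin d → ℂ, (∀ i, Z i ∈ T i) ↔ Z ∈ S := by
    intro Z
    rw [hS, hKc, mem_thickening_cube_iff hρpos]
    exact forall_congr' fun i => hmemT (Z i) i
  have hSTeq : {Z : Fin d → ℂ | ∀ i, Z i ∈ T i} = S := Set.ext hST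
  -- the analytic Abhyankar–Jung theorem
  have hA' : ∀ k, DifferentiableOn ℂ (A k) {Z : Fin d → ℂ | ∀ i, Z i ∈ T i} := fun k => by
    rw [hSTeq]; exact hAS k
  have hsep' : ∀ Z : Fin d → ℂ, (∀ i, Z i ∈ T i) → (∀ i, Z i ≠ 0) →
      (X ^ n + ∑ k : Fin n, C (A k Z) * X ^ (k : ℕ)).Separable := fun Z hZ hZ0 =>
    hsepS Z ((hST Z).1 hZ) hZ0
  obtain ⟨q, hqpos, f, hfd, hfprod⟩ := exists_roots_pow hTo hTc hTb hT0 hA' hsep'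
  -- the real neighbourhood `V = (-δ, 1+δ)ᵈ`
  obtain ⟨δ, hδpos, hδ1, hδρ, hδpow⟩ : ∃ δ : ℝ, 0 < δ ∧ δ < 1 ∧ δ < ρ ∧ (1 + δ) ^ q < 1 + ρ := by
    have hc : ContinuousAt (fun t : ℝ => (1 + t) ^ q) 0 := by fun_prop
    have hev : ∀ᶠ t in 𝓝 (0 : ℝ), (1 + t) ^ q < 1 + ρ := by
      refine hc.eventually (gt_mem_nhds ?_)
      simpa using hρpos
    obtain ⟨δ₁, hδ₁, hball⟩ := Metric.eventually_nhds_iff.1 hev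
    refine ⟨min (δ₁ / 2) (min (1 / 2) (ρ / 2)), by positivity, ?_, ?_, ?_⟩
    · linarith [min_le_right (δ₁ / 2) (min (1 / 2) (ρ / 2)), min_le_left (1 / 2 : ℝ) (ρ / 2)]
    · linarith [min_le_right (δ₁ / 2) (min (1 / 2) (ρ / 2)), min_le_right (1 / 2 : ℝ) (ρ / 2)]
    · refine hball ?_
      rw [dist_zero_right, Real.norm_eq_abs, abs_of_pos (by positivity)]
      linarith [min_le_left (δ₁ / 2) (min (1 / 2) (ρ / 2))]
  set V : Set (Fin d → ℝ) := {σ | ∀ i, σ i ∈ Ioo (-δ) (1 + δ)} with hV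
  have hVo : IsOpen V := by
    have : V = ⋂ i, (fun σ : Fin d → ℝ => σ i) ⁻¹' Ioo (-δ) (1 + δ) := by ext σ; simp [hV]
    rw [this]; exact isOpen_iInter_of_finite fun i => isOpen_Ioo.preimage (continuous_apply i)
  have hKV : K ⊆ V := fun σ hσ i => by
    have := (mem_univ_pi.1 hσ) i
    exact ⟨by linarith [this.1], by linarith [this.2]⟩
  -- powers of points of `V` are `ρ`-close to the cube
  have hpow_close : ∀ σ ∈ V, ∀ i, ∃ t ∈ Icc (0 : ℝ) 1, ‖((σ i ^ q : ℝ) : ℂ) - t‖ < ρ := by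
    intro σ hσ i
    obtain ⟨hlo, hhi⟩ := hσ i
    rcases lt_or_ge (σ i) 0 with hneg | hnn
    · refine ⟨0, ⟨le_rfl, zero_le_one⟩, ?_⟩
      rw [ofReal_zero, sub_zero, norm_real, Real.norm_eq_abs, abs_pow]
      have habs : |σ i| < δ := by rw [abs_of_neg hneg]; linarith
      calc |σ i| ^ q ≤ |σ i| ^ 1 := pow_le_pow_of_le_one (abs_nonneg _) (by linarith) hqpos
        _ < ρ := by rw [pow_one]; linarith
    · rcases le_or_gt (σ i) 1 with hle | hgt
      · refine ⟨σ i ^ q, ⟨pow_nonneg hnn _, pow_le_one₀ hnn hle⟩, ?_⟩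
        rw [sub_self, norm_zero]; exact hρpos
      · refine ⟨1, ⟨zero_le_one, le_rfl⟩, ?_⟩
        rw [← ofReal_sub, norm_real, Real.norm_eq_abs,
          abs_of_pos (by linarith [one_lt_pow₀ hgt hqpos.ne'])]
        have h1 : σ i ^ q < (1 + δ) ^ q := pow_lt_pow_left₀ hhi hnn hqpos.ne'
        linarith
  have hpowT : ∀ σ ∈ V, ∀ i, (ι σ i) ^ q ∈ T i := by
    intro σ hσ i
    rw [hmemT _ i]
    simpa [hι, ofReal_pow] using hpow_close σ hσ i
  have hpowS : ∀ σ ∈ V, ι (fun i => σ i ^ q) ∈ S := by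
    intro σ hσ
    rw [← hST]
    intro i
    have := hpowT σ hσ i
    simpa [hι, ofReal_pow] using this
  -- the roots restricted to real points
  set W : Set (Fin d → ℂ) := {Y | ∀ i, Y i ^ q ∈ T i} with hW
  have hWo : IsOpen W := by
    have : W = ⋂ i, (fun Y : Fin d → ℂ => Y i ^ q) ⁻¹' T i := by ext Y; simp [hW]
    rw [this]; exact isOpen_iInter_of_finite fun i => (hTo i).preimage (by fun_prop)
  set L : (Fin d → ℝ) →L[ℝ] (Fin d → ℂ) :=
    ContinuousLinearMap.pi fun i => Complex.ofRealCLM.comp (ContinuousLinearMap.proj i) with hL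
  have hLι : ∀ y, L y = ι y := fun y => rfl
  refine ⟨q, hqpos, V, hVo, hKV, fun σ hσ => hrealU _ (hpowS σ hσ), fun l σ => f l (ι σ), ?_, ?_⟩
  · -- analyticity of the restricted roots
    intro l σ hσ
    have hmem : ι σ ∈ W := hpowT σ hσ
    have han : AnalyticAt ℂ (f l) (ι σ) := SCV.analyticAt_of_differentiableOn (hfd l) hWo hmem
    have hanℝ : AnalyticAt ℝ (f l) (L σ) := by rw [hLι]; exact han.restrictScalars
    exact hanℝ.comp (L.analyticAt σ)
  · -- the factorisation at real points
    intro σ hσ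
    have hx : ι (fun i => σ i ^ q) ∈ S := hpowS σ hσ
    have h1 := hfprod (ι σ) (hpowT σ hσ)
    have h2 : (fun i => ι σ i ^ q) = ι (fun i => σ i ^ q) := by funext i; simp [hι, ofReal_pow]
    rw [h2, hPreal _ hx] at h1
    exact h1

end AbhyankarJung
end Literature.Analysis.Complex

end
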